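import Summits.ResolutionOfSingularities.ResolutionOfSingularities.Theorems.HilbertSamuelEliminationCampaignW42ToricMarkedDefs
import Mathlib.Data.Finset.Powerset
import Mathlib.Data.Finset.Max

/-!
# [OURS · L1 W4.2] Toric marked monomial objects in dimension 3 — the MONOMIAL CASE (Encinas–Villamayor's `Γ`):
# if every unresolved corner is principal, legal blow-ups at inclusion-minimal legal faces E-resolve the state

[OURS · L1 W4.2 · seat res-L1-s42-pv-2 gen 5] replaces the role of the «service-free single-vertex endgame» of card M
(`IdeasL1Idea2R8.minimalFace_descent`) and of the monomial case of the E-resolution of binomial basic objects (Blanco 2012 II,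
Def 1.25 `Γ`; Encinas–Villamayor) on the combinatorial model `…CampaignW42ToricMarkedDefs`; NOT a statement of the manuscript
under review, nor of CJS / Spivakovsky / Blanco.  AI work, weaker than expert review.  Pure proofs, no `sorry`, no new axiom.

THEOREM (`eresolvable_of_principal`).  Let `m > 0` and let `s` be a well-formed state with non-negative exponents in which every
corner that is not E-resolved is PRINCIPAL (one generator has minimal exponent at each of its rays).  Then `s` is E-resolvable:
a finite sequence of legal blow-ups reaches a state all of whose corners are E-resolved.
PROOF.  Blow up an inclusion-minimal legal face `R` of an unresolved corner (`Σ_R β ≥ m`, `Σ_{R∖x} β < m` for `x ∈ R`).  Every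
corner containing `R` is unresolved hence principal with a common minimiser on `R`; its children are principal and their
`β`-sums drop by at least one (`|β(child_x)| = |β(C)| + (Σ_{R∖x} β − m)`); a child with `β`-sum `< m` is resolved.  Hence the
potential `Σ_{C unresolved} 4^{|β(C)| − m}` strictly decreases (at most three children per parent), and we conclude by strong
induction.  COROLLARY (`eresolvable_initial_of_subsingleton`): a ONE-generator position (binomial hypersurface `y^m + x^a`) is
E-resolvable from its initial corner.
-/

set_option linter.dupNamespace false -- mandated namespace of this single-conjunct summit

namespace Summit.ResolutionOfSingularities.ResolutionOfSingularities.Theorems.CampaignW42.Toric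

namespace TState

open Finset

variable {ι : Type} [Fintype ι] [Nonempty ι]

section Principal

/-- In a principal cone the minimiser realises `β` at every ray. -/
theorem beta_eq_of_principal {s : TState ι} {C : Finset ℕ} {v₀ : ι} (h : ∀ v, ∀ r ∈ C, s.expo r v₀ ≤ s.expo r v)
    {r : ℕ} (hr : r ∈ C) : s.beta r = s.expo r v₀ :=
  le_antisymm (s.beta_le r v₀) (by
    obtain ⟨v, hv⟩ := s.exists_beta_eq r
    rw [hv]; exact h v r hr)

/-- In a principal cone the minimiser's order along any sub-face is the `β`-sum. -/
theorem betaSum_eq_faceSum_of_principal {s : TState ι} {C : Finset ℕ} {v₀ : ι} (h : ∀ v, ∀ r ∈ C, s.expo r v₀ ≤ s.expo r v)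
    {R : Finset ℕ} (hR : R ⊆ C) : s.betaSum R = s.faceSum R v₀ :=
  Finset.sum_congr rfl (fun _ hr => beta_eq_of_principal h (hR hr))

omit [Fintype ι] [Nonempty ι] in
/-- In a principal cone the minimiser minimises the order along every sub-face. -/
theorem faceSum_min_of_principal {s : TState ι} {C : Finset ℕ} {v₀ : ι} (h : ∀ v, ∀ r ∈ C, s.expo r v₀ ≤ s.expo r v)
    {R : Finset ℕ} (hR : R ⊆ C) (v : ι) : s.faceSum R v₀ ≤ s.faceSum R v :=
  Finset.sum_le_sum (fun r hr => h v r (hR hr))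

/-- An unresolved principal cone has `β`-sum at least `m`. -/
theorem le_betaSum_of_not_resolved {m : ℕ} {s : TState ι} {C : Finset ℕ} {v₀ : ι}
    (h : ∀ v, ∀ r ∈ C, s.expo r v₀ ≤ s.expo r v) (hC : ¬ s.Resolved m C) : (m : ℤ) ≤ s.betaSum C := by
  rw [betaSum_eq_faceSum_of_principal h (subset_refl C)]
  by_contra hlt
  exact hC ⟨v₀, lt_of_not_ge hlt⟩

/-- **Inclusion-minimal legal face** of an unresolved principal cone: `Σ_R β ≥ m` and `Σ_{R ∖ x} β < m` for every `x ∈ R`. -/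
theorem exists_minimal_face {m : ℕ} (hm : 0 < m) {s : TState ι} {C : Finset ℕ} {v₀ : ι}
    (h : ∀ v, ∀ r ∈ C, s.expo r v₀ ≤ s.expo r v) (hC : ¬ s.Resolved m C) :
    ∃ R, R ⊆ C ∧ R.Nonempty ∧ (m : ℤ) ≤ s.betaSum R ∧ ∀ x ∈ R, s.betaSum (R.erase x) < m := by
  classical
  let S := C.powerset.filter (fun R => (m : ℤ) ≤ s.betaSum R)
  have hCS : C ∈ S := by
    simp only [S, Finset.mem_filter, Finset.mem_powerset]
    exact ⟨subset_refl C, le_betaSum_of_not_resolved h hC⟩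
  obtain ⟨R, hRS, hmin⟩ := Finset.exists_min_image S Finset.card ⟨C, hCS⟩
  simp only [S, Finset.mem_filter, Finset.mem_powerset] at hRS
  refine ⟨R, hRS.1, ?_, hRS.2, fun x hx => ?_⟩
  · rw [Finset.nonempty_iff_ne_empty]
    rintro rfl
    have : s.betaSum ∅ = 0 := Finset.sum_empty
    have h2 := hRS.2
    rw [this] at h2
    omega
  · by_contra hge
    have hmem : R.erase x ∈ S := by
      simp only [S, Finset.mem_filter, Finset.mem_powerset]
      exact ⟨(Finset.erase_subset x R).trans hRS.1, le_of_not_gt hge⟩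
    have := hmin _ hmem
    rw [Finset.card_erase_of_mem hx] at this
    have hpos : 0 < R.card := Finset.card_pos.mpr ⟨x, hx⟩
    omega

/-- A face with `Σ_R β ≥ m` inside a cone of the state is legal. -/
theorem legal_of_betaSum {m : ℕ} {s : TState ι} {C R : Finset ℕ} (hC : C ∈ s.cones) (hRC : R ⊆ C) (hne : R.Nonempty)
    (hR : (m : ℤ) ≤ s.betaSum R) : s.Legal m R :=
  ⟨⟨hne, C, hC, hRC⟩, fun v => hR.trans (s.betaSum_le_faceSum R v)⟩

end Principal

section Potential

open Classical in
/-- The weight of a corner: `0` if E-resolved, else `4^{Σβ − m}`. -/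
noncomputable def weight (m : ℕ) (s : TState ι) (C : Finset ℕ) : ℕ :=
  if s.Resolved m C then 0 else 4 ^ (s.betaSum C - m).toNat

/-- The potential of the monomial case: the total weight of the corners. -/
noncomputable def pot (m : ℕ) (s : TState ι) : ℕ := ∑ C ∈ s.cones, s.weight m C

/-- A resolved corner weighs nothing. -/
theorem weight_of_resolved {m : ℕ} {s : TState ι} {C : Finset ℕ} (h : s.Resolved m C) : s.weight m C = 0 := by
  simp [weight, h]

/-- An unresolved corner weighs `4^{Σβ − m}`. -/
theorem weight_of_not_resolved {m : ℕ} {s : TState ι} {C : Finset ℕ} (h : ¬ s.Resolved m C) :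
    s.weight m C = 4 ^ (s.betaSum C - m).toNat := by
  simp [weight, h]

/-- The weight is bounded by `4^{e}` as soon as some generator has order `≤ m + e`... in the form used below: if the
minimiser's order at `C` is `< m` the weight vanishes, and in general `weight ≤ 4^{(faceSum v − m).toNat}`. -/
theorem weight_le_pow_of_faceSum {m : ℕ} {s : TState ι} {C : Finset ℕ} (v : ι) :
    s.weight m C ≤ 4 ^ (s.faceSum C v - m).toNat := by
  by_cases h : s.Resolved m C
  · rw [weight_of_resolved h]; exact Nat.zero_le _
  · rw [weight_of_not_resolved h]
    apply Nat.pow_le_pow_right (by norm_num)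
    have := s.betaSum_le_faceSum C v
    omega

/-- A corner where some generator has order `< m` weighs nothing. -/
theorem weight_eq_zero_of_faceSum_lt {m : ℕ} {s : TState ι} {C : Finset ℕ} (v : ι) (h : s.faceSum C v < m) :
    s.weight m C = 0 :=
  weight_of_resolved ⟨v, h⟩

/-- `β` of an old ray is unchanged by a blow-up. -/
theorem beta_move_of_ne {m : ℕ} {s : TState ι} {R : Finset ℕ} {r : ℕ} (hr : r ≠ s.next) :
    (s.move m R).beta r = s.beta r := by
  unfold beta
  exact congrArg _ (funext (fun v => move_expo_of_ne hr v))

/-- `β`-sums of faces avoiding the new ray are unchanged by a blow-up. -/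
theorem betaSum_move_of_not_mem {m : ℕ} {s : TState ι} {R D : Finset ℕ} (hD : s.next ∉ D) :
    (s.move m R).betaSum D = s.betaSum D :=
  Finset.sum_congr rfl (fun _ hr => beta_move_of_ne (fun h => hD (h ▸ hr)))

omit [Fintype ι] [Nonempty ι] in
/-- Resolvedness of a cone avoiding the new ray is unchanged by a blow-up. -/
theorem resolved_move_iff_of_not_mem {m : ℕ} {s : TState ι} {R D : Finset ℕ} (hD : s.next ∉ D) :
    (s.move m R).Resolved m D ↔ s.Resolved m D := by
  unfold Resolved
  simp_rw [faceSum_move_of_not_mem hD]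

/-- The weight of a cone avoiding the new ray is unchanged by a blow-up. -/
theorem weight_move_of_not_mem {m : ℕ} {s : TState ι} {R D : Finset ℕ} (hD : s.next ∉ D) :
    (s.move m R).weight m D = s.weight m D := by
  by_cases h : s.Resolved m D
  · rw [weight_of_resolved h, weight_of_resolved ((resolved_move_iff_of_not_mem hD).mpr h)]
  · rw [weight_of_not_resolved h, weight_of_not_resolved (fun h' => h ((resolved_move_iff_of_not_mem hD).mp h')),
      betaSum_move_of_not_mem hD]

omit [Fintype ι] [Nonempty ι] in
/-- Sum over a `biUnion` is at most the sum of the sums (natural numbers). -/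
theorem sum_biUnion_le {α β : Type} [DecidableEq β] (S : Finset α) (f : α → Finset β) (w : β → ℕ) :
    ∑ b ∈ S.biUnion f, w b ≤ ∑ a ∈ S, ∑ b ∈ f a, w b := by
  classical
  induction S using Finset.induction_on with
  | empty => simp
  | insert a S ha ih =>
    rw [Finset.biUnion_insert, Finset.sum_insert ha]
    have hu := Finset.sum_union_inter (s₁ := f a) (s₂ := S.biUnion f) (f := w)
    calc ∑ b ∈ f a ∪ S.biUnion f, w b ≤ ∑ b ∈ f a, w b + ∑ b ∈ S.biUnion f, w b := by omega
      _ ≤ ∑ b ∈ f a, w b + ∑ a ∈ S, ∑ b ∈ f a, w b := Nat.add_le_add_left ih _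

/-- **Key estimate.**  For an unresolved principal cone `C ⊇ R` with `R` inclusion-minimal legal, the total weight of the
children of `C` is strictly below the weight of `C`. -/
theorem sum_weight_children_lt {m : ℕ} {s : TState ι} (hwf : s.WF) {C R : Finset ℕ} (hC : C ∈ s.cones)
    {v₀ : ι} (hp : ∀ v, ∀ r ∈ C, s.expo r v₀ ≤ s.expo r v) (hnr : ¬ s.Resolved m C) (hRC : R ⊆ C)
    (hmin : ∀ x ∈ R, s.betaSum (R.erase x) < m) :
    ∑ D ∈ s.children R C, (s.move m R).weight m D < s.weight m C := by
  classical
  have hnC : s.next ∉ C := hwf.next_notMem hC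
  rw [children_of_subset hRC, weight_of_not_resolved hnr]
  -- injectivity of x ↦ insert next (C.erase x) on R
  have hinj : ∀ x ∈ R, ∀ y ∈ R, insert s.next (C.erase x) = insert s.next (C.erase y) → x = y := by
    intro x hx y hy hxy
    have hx' : s.next ∉ C.erase x := fun h => hnC (Finset.mem_of_mem_erase h)
    have hy' : s.next ∉ C.erase y := fun h => hnC (Finset.mem_of_mem_erase h)
    have : C.erase x = C.erase y := by
      have := congrArg (fun T => Finset.erase T s.next) hxy
      simpa [Finset.erase_insert hx', Finset.erase_insert hy'] using this
    exact (Finset.erase_inj C (hRC hx)).mp this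
  rw [Finset.sum_image hinj]
  -- each child has the minimiser's order ≤ betaSum C - 1
  have hchild : ∀ x ∈ R, (s.move m R).faceSum (insert s.next (C.erase x)) v₀ ≤ s.betaSum C - 1 := by
    intro x hx
    rw [faceSum_child (hRC hx) hnC v₀, ← betaSum_eq_faceSum_of_principal hp (subset_refl C),
      ← betaSum_eq_faceSum_of_principal hp hRC, ← beta_eq_of_principal hp (hRC hx)]
    have h1 := hmin x hx
    have h2 : s.betaSum (R.erase x) = s.betaSum R - s.beta x := by
      unfold betaSum; rw [Finset.sum_erase_eq_sub hx]
    omega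
  have hmC : (m : ℤ) ≤ s.betaSum C := le_betaSum_of_not_resolved hp hnr
  -- case split on the exponent
  rcases Nat.eq_zero_or_pos ((s.betaSum C - m).toNat) with he | he
  · -- betaSum C = m: every child is resolved
    have hall : ∀ x ∈ R, (s.move m R).weight m (insert s.next (C.erase x)) = 0 := by
      intro x hx
      apply weight_eq_zero_of_faceSum_lt v₀
      have := hchild x hx
      omega
    rw [Finset.sum_eq_zero hall, he]
    norm_num
  · have hbound : ∀ x ∈ R, (s.move m R).weight m (insert s.next (C.erase x)) ≤ 4 ^ ((s.betaSum C - m).toNat - 1) := by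
      intro x hx
      refine (weight_le_pow_of_faceSum v₀).trans (Nat.pow_le_pow_right (by norm_num) ?_)
      have := hchild x hx
      omega
    have hcard : R.card ≤ 3 := (Finset.card_le_card hRC).trans (hwf C hC).1.le
    calc ∑ x ∈ R, (s.move m R).weight m (insert s.next (C.erase x))
        ≤ ∑ _x ∈ R, 4 ^ ((s.betaSum C - m).toNat - 1) := Finset.sum_le_sum hbound
      _ = R.card * 4 ^ ((s.betaSum C - m).toNat - 1) := Finset.sum_const_nat (fun _ _ => rfl)
      _ ≤ 3 * 4 ^ ((s.betaSum C - m).toNat - 1) := Nat.mul_le_mul_right _ hcard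
      _ < 4 * 4 ^ ((s.betaSum C - m).toNat - 1) := by
          exact Nat.mul_lt_mul_of_pos_right (by norm_num) (Nat.pow_pos (by norm_num))
      _ = 4 ^ (s.betaSum C - m).toNat := by
          rw [← Nat.pow_succ']; congr 1; omega

/-- **Potential drop.**  Blowing up an inclusion-minimal legal face of an unresolved corner, in a state whose unresolved corners
are all principal, strictly decreases the potential. -/
theorem pot_move_lt {m : ℕ} {s : TState ι} (hwf : s.WF) (hnn : s.Nonneg)
    (hpr : ∀ C ∈ s.cones, ¬ s.Resolved m C → s.Principal C)
    {C₀ R : Finset ℕ} (hC₀ : C₀ ∈ s.cones) (hn₀ : ¬ s.Resolved m C₀) (hRC₀ : R ⊆ C₀) (hRne : R.Nonempty)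
    (hRm : (m : ℤ) ≤ s.betaSum R) (hmin : ∀ x ∈ R, s.betaSum (R.erase x) < m) :
    (s.move m R).pot m < s.pot m := by
  classical
  have hlegal : s.Legal m R := legal_of_betaSum hC₀ hRC₀ hRne hRm
  -- per-parent comparison
  have hle : ∀ C ∈ s.cones, ∑ D ∈ s.children R C, (s.move m R).weight m D ≤ s.weight m C := by
    intro C hC
    by_cases hRC : R ⊆ C
    · have hnr : ¬ s.Resolved m C := not_resolved_of_legal_subset hnn hlegal hRC
      obtain ⟨v₀, hp⟩ := hpr C hC hnr
      exact (sum_weight_children_lt hwf hC hp hnr hRC hmin).le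
    · rw [children_of_not_subset hRC, Finset.sum_singleton, weight_move_of_not_mem (hwf.next_notMem hC)]
  have hlt : ∑ D ∈ s.children R C₀, (s.move m R).weight m D < s.weight m C₀ := by
    obtain ⟨v₀, hp⟩ := hpr C₀ hC₀ hn₀
    exact sum_weight_children_lt hwf hC₀ hp hn₀ hRC₀ hmin
  calc (s.move m R).pot m = ∑ D ∈ s.cones.biUnion (s.children R), (s.move m R).weight m D := rfl
    _ ≤ ∑ C ∈ s.cones, ∑ D ∈ s.children R C, (s.move m R).weight m D := sum_biUnion_le _ _ _
    _ < ∑ C ∈ s.cones, s.weight m C := Finset.sum_lt_sum hle ⟨C₀, hC₀, hlt⟩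
    _ = s.pot m := rfl

omit [Fintype ι] [Nonempty ι] in
/-- Principality of unresolved corners is preserved by the blow-up of a legal face in such a state. -/
theorem principal_move {m : ℕ} {s : TState ι} (hwf : s.WF) (hnn : s.Nonneg)
    (hpr : ∀ C ∈ s.cones, ¬ s.Resolved m C → s.Principal C) {R : Finset ℕ} (hR : s.Legal m R) :
    ∀ D ∈ (s.move m R).cones, ¬ (s.move m R).Resolved m D → (s.move m R).Principal D := by
  classical
  intro D hD hnD
  rw [mem_move_cones] at hD
  obtain ⟨C, hC, hDC⟩ := hD
  have hnC : s.next ∉ C := hwf.next_notMem hC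
  by_cases hRC : R ⊆ C
  · have hnr : ¬ s.Resolved m C := not_resolved_of_legal_subset hnn hR hRC
    obtain ⟨v₀, hp⟩ := hpr C hC hnr
    rw [children_of_subset hRC, Finset.mem_image] at hDC
    obtain ⟨x, hx, rfl⟩ := hDC
    refine ⟨v₀, fun v r hr => ?_⟩
    rcases Finset.mem_insert.mp hr with rfl | hr'
    · rw [move_expo_next, move_expo_next]
      have := faceSum_min_of_principal hp hRC v
      omega
    · have hrC : r ∈ C := Finset.mem_of_mem_erase hr'
      have hrn : r ≠ s.next := fun h => hnC (h ▸ hrC)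
      rw [move_expo_of_ne hrn, move_expo_of_ne hrn]
      exact hp v r hrC
  · rw [children_of_not_subset hRC, Finset.mem_singleton] at hDC
    subst hDC
    have hnr : ¬ s.Resolved m D := fun h => hnD ((resolved_move_iff_of_not_mem hnC).mpr h)
    obtain ⟨v₀, hp⟩ := hpr D hC hnr
    refine ⟨v₀, fun v r hr => ?_⟩
    have hrn : r ≠ s.next := fun h => hnC (h ▸ hr)
    rw [move_expo_of_ne hrn, move_expo_of_ne hrn]
    exact hp v r hr

end Potential

section Main

/-- **[OURS · L1 W4.2] THE MONOMIAL CASE (Encinas–Villamayor `Γ`, toric form).**  A well-formed state with non-negative exponents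
all of whose unresolved corners are principal is E-resolvable by legal blow-ups (at inclusion-minimal legal faces). -/
theorem eresolvable_of_principal {m : ℕ} (hm : 0 < m) (s : TState ι) (hwf : s.WF) (hnn : s.Nonneg)
    (hpr : ∀ C ∈ s.cones, ¬ s.Resolved m C → s.Principal C) : s.EResolvable m := by
  classical
  suffices H : ∀ n (s : TState ι), s.pot m = n → s.WF → s.Nonneg →
      (∀ C ∈ s.cones, ¬ s.Resolved m C → s.Principal C) → s.EResolvable m from H _ s rfl hwf hnn hpr
  intro n
  induction n using Nat.strong_induction_on with
  | _ n ih =>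
    intro s hsn hwf hnn hpr
    by_cases hE : s.EResolved m
    · exact ⟨s, Play.refl s, hE⟩
    · obtain ⟨C₀, hC₀'⟩ := not_forall.mp hE
      obtain ⟨hC₀, hn₀⟩ := Classical.not_imp.mp hC₀'
      obtain ⟨v₀, hp⟩ := hpr C₀ hC₀ hn₀
      obtain ⟨R, hRC₀, hRne, hRm, hmin⟩ := exists_minimal_face hm hp hn₀
      have hlegal : s.Legal m R := legal_of_betaSum hC₀ hRC₀ hRne hRm
      have hlt : (s.move m R).pot m < n := hsn ▸ pot_move_lt hwf hnn hpr hC₀ hn₀ hRC₀ hRne hRm hmin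
      obtain ⟨t, hplay, ht⟩ := ih _ hlt (s.move m R) rfl (hwf.move R) (hnn.move hlegal) (principal_move hwf hnn hpr hlegal)
      exact ⟨t, Play.step R hlegal hplay, ht⟩

/-- **Corollary (binomial hypersurfaces `y^m + x^a`).**  With a single generator every cone is principal, so the initial state of a
one-generator position with non-negative exponents is E-resolvable. -/
theorem eresolvable_initial_of_subsingleton [Subsingleton ι] {m : ℕ} (hm : 0 < m) (a : Fin 3 → ι → ℤ)
    (ha : ∀ k v, 0 ≤ a k v) : (initial a).EResolvable m :=
  eresolvable_of_principal hm _ (initial_WF a) (initial_nonneg a ha)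
    (fun _ _ _ => ⟨Classical.arbitrary ι, fun v r _ => by rw [Subsingleton.elim v (Classical.arbitrary ι)]⟩)

end Main

end TState

end Summit.ResolutionOfSingularities.ResolutionOfSingularities.Theorems.CampaignW42.Toric
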